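import Summits.CriticalPhenomena.Ising3DConformalLimit.Theses.FKParityRobustness
import Summits.CriticalPhenomena.Ising3DConformalLimit.Theorems.FKParityRobustnessDefs
import Literature.Combinatorics.SimpleGraph.CycleSpaceSeparators
import Literature.Probability.LatticeModels.CriticalTwoPointLower
import Literature.Probability.LatticeModels.RandomClusterFKG

/-!
# Disproof work file — crux `ParityRobustMerging` (stmt-CriticalPhenomena-11253), route FKParityRobustness

Standing disprover `refuter-cdisprove-stmt-CriticalPhenomena-11253-0` (cycle 1, 2026-08-16).
Findings (numbers, not adjectives; details in the docstrings):

* § 0 ELABORATION / JUNK.  The crux elaborates (rc 0, W.lean); `φ = rcMeasure G_N (fkIsingParam β_c) 2 ∅`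
  is a genuine probability measure (`fkIsingParam_mem_Icc (criticalBeta_nonneg 3)`, `q = 2 > 0`),
  `∫ u dφ` is a finite sum (`integral_rcMeasure`; `MeasurableSingletonClass (Set (Sym2 ↥(box 3 N)))`),
  `u = 0/0 = 0` off `𝓕_A`; the numerator of `u` elaborates through the `Finset`-monad coercion
  (value-preserving, refuter rattack's `quirk_card_eq`).  No Lean-level counterexample is possible:
  the statement is a quantitative claim about critical FK-Ising on `ℤ³` (§ D).
* § A LOAD-BEARING HYPOTHESES (LANDED: `Theorems/ParityRobustMerging/Negative/LoadBearingHypotheses.lean`,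
  p73172 accepted 2026-08-16T01:10Z, namespace `…Ising3DConformalLimit.ParityRobustMergingNegative`).
  The crux has ONE hypothesis, `1 ≤ l`; it is load-bearing:
  `parityRobustMerging_false_without_hl` (at `l = 0` the sources coincide, no `T`-join with odd set
  `{0}` exists by the handshake lemma, so `u ≡ 0` while `φ[all joined] = 1`).  It enters ONLY through
  the injectivity of `a`.  Same mechanism for the picked line's transfer stub:
  `fkTransfer_false_without_injective` — `stub_fkLoopTransfer` with `Function.Injective a` dropped is
  false (constant `a` on the one-point graph: hypothesis `c·Z(A) ≤ Z(A;C)` reads `c·0 ≤ 0`, conclusion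
  `c·1 ≤ 0`), so its proof must use injectivity (it does: `{J} ⊆ 𝓕_A` needs two genuine pairing paths).
* § A′ NATURAL STRENGTHENING REFUTED (the H-world, `not_graphUniformBLOB`, proposed as
  `Theorems/ParityRobustMerging/Negative/HWorld.lean`): ONE constant for ALL finite graphs is impossible —
  on the H-shaped tree (four leaves = sources, two hubs, one bridge) hub parity expels the bridge from
  every `T`-join, so `u ≡ 0` while `φ[J] > 0`.  FKG, finite energy, domain Markov and the FK ↔ loop
  dictionary all hold on the H-tree: a proof of the crux must use the geometry of `Λ_N ⊂ ℤ³` proper.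
* § B TARGETS (the lead's stubs, skeleton `Lines/plaquette-xor-surgery.lean`, 5 stubs, 2 landed):
  `stub_xorTransport`, `stub_massSplit` PROVED (p71741, p72240); `stub_fkLoopTransfer` is a correct
  finite identity chain (re-derived in § B: `E_φ[#{F ∈ 𝒯_A(ω) : P}/#𝒯_A(ω)] = Z_t(A;P)/Z_t(∅)` with
  `t = p/(2-p) = tanh β`, constant fixed by `A = ∅`); `stub_nearTouch` (NT) and `stub_pivotalSparsity`
  (PS) are the physics.  NT is predicted FALSE in both regimes `x₄ ≠ 3` (§ D), PS true; neither is
  decidable in Lean — they are Monte-Carlo questions, § C.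
* § C NUMERICS (kit jobs j008062 self-test, j008214 3D l=1–3, j008215 3D l=4–8, j008216 2D control +
  literal free boxes; Swendsen–Wang + EXACT uniform `T`-join sampling, 64 bit-packed samples per
  placement, all translations of a torus `L ≥ 6l` as placements; measures `P4 = φ[J]`, `φ[J | 𝓕_A]`,
  `E[u_A | J]` (BLOB ratio), `ℓ^A[C]` (C⁺ ratio), `ntMass/Z(A;H)` (NT ratio), `pivMass/Z(A;C)` (PS
  ratio), `E_ℓA[#adjacent K₁~K₂ pairs | H]`, with the XorTransport identity `t⁴E[#nt;H] = E[#piv;C]`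
  as an in-run correctness check).  Results: PENDING (cluster queue) — to be filled in at the next
  boundary; the decision rule is in § C.
* § D WHY IT RESISTS / WHERE IT SHOULD BREAK.  `E[u | J](l) ≍ ℓ^A[C]/φ[J|𝓕_A] ≍ l^{3-x₄}` with
  `x₄ = Δ_{T₄}(O(n→1), d = 3) ≈ 3.2 > 3` (4-leg watermelon = rank-4 tensor; the `L = 2` member of the
  same dictionary, `D_HT = 3 - Δ_{T₂}(n→1) = 1.735`, matches the measured `1.7349(65)` of
  WinterJankeSchakel2008) — a SLOW power decay `≈ l^{-0.2}`: the crux as filed is most likely FALSE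
  but only by a logarithm-like margin over accessible `l`, and certainly not refutable in Lean.
-/

noncomputable section

open MeasureTheory Finset
open Literature.Probability.LatticeModels
open Literature.Combinatorics.SimpleGraph.CycleSpace
open Summit.CriticalPhenomena.Ising3DConformalLimit.Cruxes.ParityRobustMerging.PlaquetteXorSurgery

namespace Summit.CriticalPhenomena.Ising3DConformalLimit.Cruxes.ParityRobustMerging.Disproof

open scoped Classical

/-! ## § A. Load-bearing analysis -/

section General

variable {V : Type*} [Fintype V] [DecidableEq V] (G : SimpleGraph V) [DecidableRel G.Adj]

/-- If the four sources coincide, the crux's `sol ω` (`T`-joins of `A = image a` inside `ω`) is EMPTY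
for every `ω`: a `T`-join would have exactly one odd-degree vertex, contradicting the handshake lemma
in its component (`exists_reachable_odd_of_odd`). [folklore] -/
theorem sol_eq_empty_of_const (a : Fin 4 → V) (ha : ∀ i, a i = a 0) (ω : Set (Sym2 V)) :
    G.edgeFinset.powerset.filter (fun F : Finset (Sym2 V) => (↑F : Set (Sym2 V)) ⊆ ω ∧
      ∀ v, Odd (F.filter (fun e => v ∈ e)).card ↔ v ∈ Finset.univ.image a) = ∅ := by
  refine Finset.filter_eq_empty_iff.2 ?_
  rintro F hF ⟨-, hpar⟩
  have hFE : ∀ e ∈ F, ¬ e.IsDiag := fun e he =>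
    SimpleGraph.not_isDiag_of_mem_edgeSet G (SimpleGraph.mem_edgeFinset.1 (Finset.mem_powerset.1 hF he))
  have h0 : Odd (edgeDeg F (a 0)) := (hpar (a 0)).2 (Finset.mem_image_of_mem a (Finset.mem_univ 0))
  obtain ⟨w, hw, -, hwodd⟩ := exists_reachable_odd_of_odd F hFE h0
  obtain ⟨i, -, hi⟩ := Finset.mem_image.1 ((hpar w).1 hwodd)
  exact hw (hi.symm.trans (ha i))

/-- Same fact for the line's vocabulary: `tJoins G ω (image a) = ∅` when `a` is constant. [folklore] -/
theorem tJoins_image_eq_empty_of_const (a : Fin 4 → V) (ha : ∀ i, a i = a 0) (ω : Set (Sym2 V)) :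
    tJoins G ω (Finset.univ.image a) = ∅ := by
  refine Finset.eq_empty_iff_forall_notMem.2 fun F hF => ?_
  obtain ⟨hFG, -, hpar⟩ := (mem_tJoins G).1 hF
  have hFE : ∀ e ∈ F, ¬ e.IsDiag := fun e he =>
    SimpleGraph.not_isDiag_of_mem_edgeSet G (SimpleGraph.mem_edgeFinset.1 (hFG he))
  have h0 : Odd (edgeDeg F (a 0)) := (hpar (a 0)).2 (Finset.mem_image_of_mem a (Finset.mem_univ 0))
  obtain ⟨w, hw, -, hwodd⟩ := exists_reachable_odd_of_odd F hFE h0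
  obtain ⟨i, -, hi⟩ := Finset.mem_image.1 ((hpar w).1 hwodd)
  exact hw (hi.symm.trans (ha i))

/-- Hence every loop-O(1) mass of the line vanishes for constant sources. [folklore] -/
theorem zMass_eq_zero_of_const (t : ℝ) (a : Fin 4 → V) (ha : ∀ i, a i = a 0)
    (P : Finset (Sym2 V) → Prop) : zMass G t a P = 0 := by
  simp [zMass, tJoins_image_eq_empty_of_const G a ha]

end General

/-- The crux with its only hypothesis `1 ≤ l` DROPPED (everything else verbatim). -/
def ParityRobustMergingWithoutHl : Prop :=
  let tetra : Fin 4 → Literature.Probability.LatticeModels.Site 3 := ![![-1, -1, -1], ![1, 1, -1], ![1, -1, 1], ![-1, 1, 1]]; ∃ c : ℝ, 0 < c ∧ ∀ l : ℕ, ∃ N₀ : ℕ, ∀ N : ℕ, N₀ ≤ N → ∀ a : Fin 4 → ↥(Literature.Probability.LatticeModels.box 3 N), (∀ i, ((a i : Literature.Probability.LatticeModels.Site 3)) = (l : ℤ) • tetra i) → (let G := ((Literature.Probability.LatticeModels.zdGraph 3).comap (Subtype.val : ↥(Literature.Probability.LatticeModels.box 3 N) → Literature.Probability.LatticeModels.Site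 3)); let φ := Literature.Probability.LatticeModels.rcMeasure G (Literature.Probability.LatticeModels.fkIsingParam (Literature.Probability.LatticeModels.criticalBeta 3)) 2 ∅; let sol : Set (Sym2 ↥(Literature.Probability.LatticeModels.box 3 N)) → Finset (Finset (Sym2 ↥(Literature.Probability.LatticeModels.box 3 N))) := fun ω => G.edgeFinset.powerset.filter (fun F => (↑F : Set (Sym2 ↥(Literature.Probability.LatticeModels.box 3 N))) ⊆ ω ∧ ∀ v, Odd (F.filter (fun e => v ∈ e)).card ↔ v ∈ Finset.univ.image a); let u : Set (Sym2 ↥(Literature.Probability.LatticeModels.box 3 N)) → ℝ := fun ω => (((sol ω).filter (fun F => ∀ i j, (SimpleGraph.fromEdgeSet (↑F : Set (Sym2 ↥(Literature.Probability.LatticeModels.box 3 N)))).Reachable (a i) (a j))).card : ℝ) / ((sol ω).card : ℝ); c * φ.real {ω | ∀ i j, (Literature.Probability.Percolation.openGraph ω).Reachable (a i) (a j)} ≤ ∫ ω, u ω ∂φ)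

/-- **`1 ≤ l` is load-bearing.**  Without it, take `l = 0`: the four sources all sit at the origin, the
all-joined event is sure (`φ` is a probability measure) while `sol ω = ∅` for every `ω`
(`sol_eq_empty_of_const`), so `u ≡ 0/0 = 0` and the inequality reads `c · 1 ≤ 0`, absurd for `c > 0`.
Moral for provers: the hypothesis enters ONLY through the injectivity of `a` (four distinct sources);
nothing else distinguishes `l ≥ 1` from `l = 0`. [folklore] -/
theorem parityRobustMerging_false_without_hl : ¬ ParityRobustMergingWithoutHl := by
  rintro ⟨c, hc, h⟩
  obtain ⟨N₀, hN⟩ := h 0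
  set a : Fin 4 → ↥(box 3 N₀) := fun _ => ⟨0, zero_mem_box 3 N₀⟩ with ha_def
  have ha : ∀ i, ((a i : Site 3)) = ((0 : ℕ) : ℤ) •
      (![![-1, -1, -1], ![1, 1, -1], ![1, -1, 1], ![-1, 1, 1]] : Fin 4 → Site 3) i := by
    intro i; simp [ha_def]
  have key := hN N₀ le_rfl a ha
  have ha0 : ∀ i, a i = a 0 := fun _ => rfl
  have hsol := sol_eq_empty_of_const ((zdGraph 3).comap (Subtype.val : ↥(box 3 N₀) → Site 3)) a ha0
  have hset : {ω : Set (Sym2 ↥(box 3 N₀)) |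
      ∀ i j : Fin 4, (Literature.Probability.Percolation.openGraph ω).Reachable (a i) (a j)} = Set.univ :=
    Set.eq_univ_of_forall fun ω i j => SimpleGraph.Reachable.refl _
  haveI : IsProbabilityMeasure (rcMeasure ((zdGraph 3).comap (Subtype.val : ↥(box 3 N₀) → Site 3))
      (fkIsingParam (criticalBeta 3)) 2 ∅) :=
    isProbabilityMeasure_rcMeasure _ (fkIsingParam_mem_Icc (criticalBeta_nonneg 3)) (by norm_num) _
  simp only [hsol, hset, probReal_univ, Finset.card_empty, Nat.cast_zero, div_zero,
    integral_zero, mul_one] at key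
  exact absurd key (not_le.2 hc)

/-- **`Function.Injective a` is load-bearing in `stub_fkLoopTransfer`.**  The line's transfer stub
(`FKTransfer` of `Lines/plaquette-xor-surgery.lean`) with the injectivity hypothesis dropped is FALSE:
on the one-point graph with the constant source map and `c = 1`, `β = 0`, both loop masses vanish
(`zMass_eq_zero_of_const`: no `T`-join has odd set a singleton), so the hypothesis `c·Z(A) ≤ Z(A;C)`
holds, while the conclusion reads `1 · φ[all joined] = 1 ≤ ∫ u dφ = 0`.  So the stub's proof must use
injectivity — it does so exactly once, in `{all aᵢ joined} ⊆ 𝓕_A` (two pairing PATHS with distinct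
ends are needed to build a `T`-join).  Statement = the stub verbatim minus `Function.Injective a →`.
[folklore] -/
theorem fkTransfer_false_without_injective :
    ¬ ∀ (V : Type) [Fintype V] [DecidableEq V] (G : SimpleGraph V) [DecidableRel G.Adj] (β : ℝ),
      0 ≤ β → ∀ a : Fin 4 → V, ∀ c : ℝ,
        c * zMass G (Real.tanh β) a (fun _ => True) ≤ zMass G (Real.tanh β) a (fun F => JoinsAll a F) →
  (let φ := Literature.Probability.LatticeModels.rcMeasure G (Literature.Probability.LatticeModels.fkIsingParam β) 2 ∅; let sol : Set (Sym2 V) → Finset (Finset (Sym2 V)) := fun ω => G.edgeFinset.powerset.filter (fun F => (↑F : Set (Sym2 V)) ⊆ ω ∧ ∀ v, Odd (F.filter (fun e => v ∈ e)).card ↔ v ∈ Finset.univ.image a); let u : Set (Sym2 V) → ℝ := fun ω => (((sol ω).filter (fun F => ∀ i j, (SimpleGraph.fromEdgeSet (↑F : Set (Sym2 V))).Reachable (a i) (a j))).card : ℝ) / ((sol ω).card : ℝ); c * φ.real {ω | ∀ i j, (Literature.Probability.Percolation.openGraph ω).Reachable (a i) (a j)} ≤ ∫ ω, u ω ∂φ)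 := by
  intro h
  set a : Fin 4 → Unit := fun _ => () with ha_def
  have ha0 : ∀ i, a i = a 0 := fun _ => rfl
  have hyp : (1 : ℝ) * zMass (⊥ : SimpleGraph Unit) (Real.tanh 0) a (fun _ => True) ≤
      zMass (⊥ : SimpleGraph Unit) (Real.tanh 0) a (fun F => JoinsAll a F) := by
    rw [zMass_eq_zero_of_const _ _ a ha0, zMass_eq_zero_of_const _ _ a ha0, mul_zero]
  have key := h Unit ⊥ 0 le_rfl a 1 hyp
  have hsol := sol_eq_empty_of_const (⊥ : SimpleGraph Unit) a ha0
  have hset : {ω : Set (Sym2 Unit) |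
      ∀ i j : Fin 4, (Literature.Probability.Percolation.openGraph ω).Reachable (a i) (a j)} = Set.univ :=
    Set.eq_univ_of_forall fun ω i j => SimpleGraph.Reachable.refl _
  haveI : IsProbabilityMeasure (rcMeasure (⊥ : SimpleGraph Unit) (fkIsingParam 0) 2 ∅) :=
    isProbabilityMeasure_rcMeasure _ (fkIsingParam_mem_Icc le_rfl) (by norm_num) _
  simp only [hsol, hset, probReal_univ, Finset.card_empty, Nat.cast_zero, div_zero,
    integral_zero, mul_one] at key
  exact absurd key (by norm_num)

/-! ## § A′. The H-world: no graph-uniform BLOB (natural strengthening refuted) -/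

section HWorld

/-- The edge set of the H-shaped tree on six vertices: leaves `0,1` hang on hub `4`, leaves `2,3` on
hub `5`, bridge `4–5` (local notation; theorem-only file). -/
local notation "hEdges" => ({s(0,4), s(1,4), s(2,5), s(3,5), s(4,5)} : Finset (Sym2 (Fin 6)))

/-- The H-shaped tree as a simple graph on `Fin 6`. -/
local notation "hTree" => (SimpleGraph.fromEdgeSet
  ((({s(0,4), s(1,4), s(2,5), s(3,5), s(4,5)} : Finset (Sym2 (Fin 6))) : Set (Sym2 (Fin 6)))))

/-- The four sources: the leaves `0,1,2,3`. -/
local notation "hSrc" => (![0, 1, 2, 3] : Fin 4 → Fin 6)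

/-- The four leaves are distinct sources. [folklore] -/
theorem hSrc_injective : Function.Injective hSrc := by decide

/-- The source set is `{0,1,2,3}`. [folklore] -/
theorem image_hSrc : Finset.univ.image hSrc = {0, 1, 2, 3} := by decide

/-- The H-tree has no loops. [folklore] -/
theorem hEdges_not_isDiag : ∀ e ∈ hEdges, ¬ e.IsDiag := by decide

/-- The edge finset of the H-tree is `hEdges` (for every `Fintype` instance on its edge set). [folklore] -/
theorem hTree_edgeFinset {inst : Fintype (hTree).edgeSet} :
    @SimpleGraph.edgeFinset (Fin 6) hTree inst = hEdges := by
  ext e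
  rw [SimpleGraph.mem_edgeFinset, SimpleGraph.edgeSet_fromEdgeSet]
  simp only [Set.mem_sdiff, Finset.mem_coe]
  exact ⟨fun h => h.1, fun h => ⟨h, hEdges_not_isDiag e h⟩⟩

/-- Walks stay inside a set closed under adjacency. [folklore] -/
theorem mem_of_reachable_of_closed {V : Type*} {G : SimpleGraph V} {S : Set V}
    (hS : ∀ u v, G.Adj u v → u ∈ S → v ∈ S) {u v : V} (h : G.Reachable u v) (hu : u ∈ S) : v ∈ S := by
  obtain ⟨p⟩ := h
  induction p with
  | nil => exact hu
  | cons hadj _ ih => exact ih (hS _ _ hadj hu)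

/-- A leaf edge is forced into `F` by odd parity at its leaf. [folklore] -/
theorem mem_of_odd_leaf {F : Finset (Sym2 (Fin 6))} (hF : F ⊆ hEdges) {v : Fin 6} {e₀ : Sym2 (Fin 6)}
    (huniq : ∀ e ∈ hEdges, v ∈ e → e = e₀) (hodd : Odd (F.filter (fun e => v ∈ e)).card) : e₀ ∈ F := by
  have hsub : F.filter (fun e => v ∈ e) ⊆ {e₀} := by
    intro e he
    rw [Finset.mem_filter] at he
    rw [Finset.mem_singleton]
    exact huniq e (hF he.1) he.2
  have hle : (F.filter (fun e => v ∈ e)).card ≤ 1 := by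
    simpa using Finset.card_le_card hsub
  have h1 : (F.filter (fun e => v ∈ e)).card = 1 := by
    rcases hodd with ⟨k, hk⟩
    omega
  obtain ⟨e, he⟩ := Finset.card_eq_one.1 h1
  have hein : e ∈ F.filter (fun e => v ∈ e) := by rw [he]; exact Finset.mem_singleton_self e
  have : e = e₀ := Finset.mem_singleton.1 (hsub hein)
  subst this
  exact (Finset.mem_filter.1 hein).1

/-- **The H-world.** On the H-tree every `T`-join of the four leaves inside ANY edge set consists of the
four leaf edges (parity at the hubs expels the bridge), hence never joins the leaves `0` and `2`. [folklore] -/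
theorem hTree_tJoin_not_joinsAll (F : Finset (Sym2 (Fin 6))) (hF : F ⊆ hEdges)
    (hpar : ∀ v, Odd (F.filter (fun e => v ∈ e)).card ↔ v ∈ Finset.univ.image hSrc) :
    ¬ ∀ i j, (SimpleGraph.fromEdgeSet (↑F : Set (Sym2 (Fin 6)))).Reachable (hSrc i) (hSrc j) := by
  rw [image_hSrc] at hpar
  have h04 : s(0,4) ∈ F := mem_of_odd_leaf hF (by decide) ((hpar 0).2 (by decide))
  have h14 : s(1,4) ∈ F := mem_of_odd_leaf hF (by decide) ((hpar 1).2 (by decide))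
  -- the bridge is not in F: otherwise vertex 4 has degree 3
  have h45 : s(4,5) ∉ F := by
    intro h45
    have hsub : ({s(0,4), s(1,4), s(4,5)} : Finset (Sym2 (Fin 6))) ⊆ F.filter (fun e => (4 : Fin 6) ∈ e) := by
      intro e he
      simp only [Finset.mem_insert, Finset.mem_singleton] at he
      rw [Finset.mem_filter]
      rcases he with rfl | rfl | rfl
      · exact ⟨h04, by decide⟩
      · exact ⟨h14, by decide⟩
      · exact ⟨h45, by decide⟩
    have hsup : F.filter (fun e => (4 : Fin 6) ∈ e) ⊆ ({s(0,4), s(1,4), s(4,5)} : Finset (Sym2 (Fin 6))) := by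
      intro e he
      rw [Finset.mem_filter] at he
      have : ∀ e ∈ hEdges, (4 : Fin 6) ∈ e → e ∈ ({s(0,4), s(1,4), s(4,5)} : Finset (Sym2 (Fin 6))) := by
        decide
      exact this e (hF he.1) he.2
    have heq : F.filter (fun e => (4 : Fin 6) ∈ e) = {s(0,4), s(1,4), s(4,5)} :=
      Finset.Subset.antisymm hsup hsub
    have hcard : (F.filter (fun e => (4 : Fin 6) ∈ e)).card = 3 := by rw [heq]; decide
    have hodd : Odd (F.filter (fun e => (4 : Fin 6) ∈ e)).card := by rw [hcard]; decide
    exact absurd ((hpar 4).1 hodd) (by decide)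
  -- S = {0,1,4} is closed in the graph spanned by F
  intro hconn
  have hS : ∀ u v, (SimpleGraph.fromEdgeSet (↑F : Set (Sym2 (Fin 6)))).Adj u v →
      u ∈ (↑({0, 1, 4} : Finset (Fin 6)) : Set (Fin 6)) → v ∈ (↑({0, 1, 4} : Finset (Fin 6)) : Set (Fin 6)) := by
    intro u v huv hu
    rw [SimpleGraph.fromEdgeSet_adj, Finset.mem_coe] at huv
    rw [Finset.mem_coe] at hu ⊢
    have he : s(u, v) ∈ hEdges := hF huv.1
    have hne : s(u, v) ≠ s(4,5) := fun h => h45 (h ▸ huv.1)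
    clear huv
    revert u v
    decide
  have h2 := mem_of_reachable_of_closed hS (hconn 0 2) (by decide)
  rw [Finset.mem_coe] at h2
  exact absurd h2 (by decide)


/-- All four leaves are joined in the H-tree itself. [folklore] -/
theorem hTree_reachable : ∀ i j, (hTree).Reachable (hSrc i) (hSrc j) := by decide

/-- `p_c = 1 - e^{-2β_c(3)} > 0`, from `β_c(3) > 0` (`criticalBeta_pos_holds`). [folklore] -/
theorem fkIsingParam_criticalBeta_pos : 0 < fkIsingParam (criticalBeta 3) := by
  have hβ : 0 < criticalBeta 3 := criticalBeta_pos_holds (d := 3) (by norm_num)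
  have : Real.exp (-2 * criticalBeta 3) < 1 := Real.exp_lt_one_iff.2 (by linarith)
  simp only [fkIsingParam]; linarith

/-- `1 - e^{-2β} < 1`. [folklore] -/
theorem fkIsingParam_lt_one (β : ℝ) : fkIsingParam β < 1 := by
  have := Real.exp_pos (-2 * β)
  simp only [fkIsingParam]; linarith

open scoped Classical in
/-- The all-joined event has positive probability under the H-tree's FK-Ising measure (the all-open
configuration alone has positive weight). [folklore] -/
theorem hTree_allJoined_pos :
    0 < (rcMeasure hTree (fkIsingParam (criticalBeta 3)) 2 ∅).real
      {ω | ∀ i j, (Literature.Probability.Percolation.openGraph ω).Reachable (hSrc i) (hSrc j)} := by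
  set p := fkIsingParam (criticalBeta 3) with hp_def
  have hp : p ∈ Set.Icc (0 : ℝ) 1 := fkIsingParam_mem_Icc (criticalBeta_nonneg 3)
  have hp0 : 0 < p := fkIsingParam_criticalBeta_pos
  have hp1 : 0 < 1 - p := sub_pos.2 (fkIsingParam_lt_one _)
  have hq : (0 : ℝ) < 2 := by norm_num
  have hZ := rcPartitionFunction_pos hTree hp hq ∅
  rw [rcMeasure_real_apply hTree hp hq ∅]
  refine lt_of_lt_of_le ?_ (Finset.single_le_sum (fun ω _ => ?_) (Finset.mem_powerset_self _))
  · rw [if_pos ?hall]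
    case hall =>
      simp only [Set.mem_setOf_eq, Literature.Probability.Percolation.openGraph, SimpleGraph.coe_edgeFinset,
        SimpleGraph.fromEdgeSet_edgeSet]
      exact hTree_reachable
    refine div_pos ?_ hZ
    simp only [rcWeight]
    exact mul_pos (mul_pos (pow_pos hp0 _) (pow_pos hp1 _)) (pow_pos two_pos _)
  · split_ifs
    · exact div_nonneg (rcWeight_nonneg hTree hp hq.le ∅ ω) hZ.le
    · exact le_rfl

open scoped Classical in
/-- **No graph-uniform BLOB (the H-world).**  The natural strengthening of the crux to ALL finite graphs —
one constant `c > 0` with `c·φ_G[all aᵢ joined] ≤ ∫ u_a dφ_G` for every finite graph `G` and every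
injective source map `a` (same critical FK-Ising parameter, same `u`) — is FALSE: on the H-shaped tree
(`hTree`, sources = the four leaves) every `T`-join of the leaves inside any `ω` is the set of the four
leaf edges (`hTree_tJoin_not_joinsAll`), so `u ≡ 0`, while the all-joined event has positive
probability (`hTree_allJoined_pos`).  This is the formal H-shaped merger: four FK-arms tied 2|2 through
a bridge are parity-fragile.  Any proof of the crux must use the geometry of `Λ_N ⊂ ℤ³` beyond
finiteness. [folklore] -/
theorem not_graphUniformBLOB :
    ¬ ∃ c : ℝ, 0 < c ∧ ∀ (V : Type) [Fintype V] [DecidableEq V] (G : SimpleGraph V) [DecidableRel G.Adj]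
      (a : Fin 4 → V), Function.Injective a →
  (let φ := Literature.Probability.LatticeModels.rcMeasure G (Literature.Probability.LatticeModels.fkIsingParam (Literature.Probability.LatticeModels.criticalBeta 3)) 2 ∅; let sol : Set (Sym2 V) → Finset (Finset (Sym2 V)) := fun ω => G.edgeFinset.powerset.filter (fun F => (↑F : Set (Sym2 V)) ⊆ ω ∧ ∀ v, Odd (F.filter (fun e => v ∈ e)).card ↔ v ∈ Finset.univ.image a); let u : Set (Sym2 V) → ℝ := fun ω => (((sol ω).filter (fun F => ∀ i j, (SimpleGraph.fromEdgeSet (↑F : Set (Sym2 V))).Reachable (a i) (a j))).card : ℝ) / ((sol ω).card : ℝ); c * φ.real {ω | ∀ i j, (Literature.Probability.Percolation.openGraph ω).Reachable (a i) (a j)} ≤ ∫ ω, u ω ∂φ) := by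
  rintro ⟨c, hc, h⟩
  have key := h (Fin 6) hTree hSrc hSrc_injective
  simp only at key
  have hint : c * (rcMeasure hTree (fkIsingParam (criticalBeta 3)) 2 ∅).real
      {ω | ∀ i j, (Literature.Probability.Percolation.openGraph ω).Reachable (hSrc i) (hSrc j)} ≤ 0 := by
    refine key.trans_eq (integral_eq_zero_of_ae (Filter.Eventually.of_forall fun ω => ?_))
    simp only [Pi.zero_apply]
    refine div_eq_zero_iff.2 (Or.inl ?_)
    rw [Nat.cast_eq_zero, Finset.card_eq_zero, Finset.filter_eq_empty_iff]
    intro s hs hconn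
    obtain ⟨F, hF, hsF⟩ := Finset.mem_sup.1 hs
    have hsF' : s = ↑F := Finset.mem_singleton.1 hsF
    subst hsF'
    simp only [Finset.mem_filter, Finset.mem_powerset] at hF
    have hFE : F ⊆ hEdges := by
      have h1 := hF.1
      rwa [hTree_edgeFinset] at h1
    exact hTree_tJoin_not_joinsAll F hFE hF.2.2 hconn
  have hpos := hTree_allJoined_pos
  nlinarith



end HWorld

/-! ## § B. Targets — the stubs of the picked line `plaquette-xor-surgery`

Registered stubs (`ledger workitem get stmt-CriticalPhenomena-11253`, skeleton 5e696317a93c):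
`stub_xorTransport` (PROVED, p72240), `stub_massSplit` (PROVED, p71741), `stub_nearTouch` (NT),
`stub_pivotalSparsity` (PS), `stub_fkLoopTransfer` (FKTransfer).

* FKTransfer — believed TRUE; re-derivation of its dictionary (for the prover): for `F ⊆ E(G)` with
  `odd(F) = A`, `∑_{ω ⊇ F} φ_{p,2}(ω)·2^{-c(ω)} = (1-p)^{|E|} 2^{|V|} (1+x)^{|E|} (x/(1+x))^{|F|} / Z_RC`
  with `x = p/(2(1-p))`, `x/(1+x) = p/(2-p) = tanh β`; the prefactor is fixed to `1/Z_t(∅)` by the case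
  `A = ∅` (`E_φ[#𝒯_∅/#𝒯_∅] = 1`).  Hence `∫ u dφ = Z_t(A;C)/Z_t(∅)` and `φ(𝓕_A) = Z_t(A)/Z_t(∅)`;
  with `{J} ⊆ 𝓕_A` (injectivity!, `fkTransfer_false_without_injective`) and `Z_t(∅) ≥ 1` the stub
  follows for every real `c` (for `c < 0` both sides are trivial).  No attack.
* NT — `c·Z(A;H) ≤ ntMass`, i.e. `E_ℓA[#nearTouch | H] ≥ c/t_c⁴` uniformly in `l`.  Predicted FALSE:
  in the repulsive regime `x₄ > 3` (§ D) `E[#nearTouch ; H]/Z(A) ≍ l^{3-x₄} → 0` while `ℓ^A[H] → 1`;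
  in the attractive regime `x₄ < 3` conditioning on `H` forces macroscopic avoidance.  Only the
  marginal case `x₄ = 3` supports NT.  Not decidable in Lean; measured in § C as `NT_ratio(l)`.
* PS — `pivMass ≤ C·Z(A;C)`, i.e. `E_ℓA[#pivotal plaquettes | C] ≤ C`.  Predicted TRUE in every regime
  (junctions are local; a pivotal full plaquette costs `t_c⁴ = 2.26e-3` per link).  Measured in § C as
  `piv_given_C(l)`.  No attack.
* Consequence for the lead: by `ntMass = pivMass` (landed), NT ∧ PS ⟺ `Z(A;C)/Z(A;H) ≥ c/C`, i.e. the
  line proves exactly `C⁺ : ℓ^A[C] ≥ c'`, which is STRONGER than the crux (`BLOB ⟺ ℓ^A[C] ≥ c·φ[J|𝓕_A]`)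
  and is the quantity predicted to decay like `l^{3-x₄}`.

## § C. Numerics (Monte-Carlo; decision rule)

Jobs (kit, bundle `mc/` of this seat: `core.py`, `exact.py`, `main.py`; results auto-attach to the item):
j008062 self-test (exact enumeration on `Q₃` with alternate corners and on the `3×3` grid vs the sampler,
plus the XorTransport identity on a `6³` torus); j008214 `T³_L`, `(l,L) = (1,12),(2,16),(2,24),(3,24)`;
j008215 `(4,32),(6,48),(8,48),(8,64)`; j008216 2D control `(1,16),(2,32),(4,64),(8,128)` and the LITERAL
free boxes of the crux `(l,N) = (1,3),(1,5),(2,6)`.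
Reading rule (to be applied when the numbers land; recorded here BEFORE seeing them):
`u_given_J(l)` flat within errors over `l = 1…8` AND `ellC(l)` flat ⇒ consistent with BLOB and C⁺ (no kill,
line alive); `u_given_J(l) ∝ l^{-a}`, `a ≥ 0.15` with the 2D control showing its predicted `l^{-0.6}` ⇒
evidence AGAINST the crux as filed (report `refutation-evidence:` note, not a Lean refutation; planner's
kill criterion = pivot to the single-current rung); `NT_ratio(l)` decaying with `piv_given_C(l)` flat ⇒
`stub_nearTouch` is the false stub of the line (stub-false evidence note for the lead).

## § D. Why it resists, and where it should break

No rigorous inequality separates the two sides: ParityBound gives `E_φ[u] ≤ |U₄|/2`, FKG gives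
`φ[J] ≥ G(2√2 l)³`, the tree-diagram bound gives `|U₄(A_l)| ≲ l^{3-4(1+η)}`; these are compatible with
both BLOB and ¬BLOB in `d = 3` (they separate only in `d > 4`, barrier `IsingTrivialityFromDimensionFour`,
complied with by the route).  The deciding quantity is the same-configuration contact exponent of two
critical high-temperature strands, `x₄`; field theory (rank-`L` tensor dimensions of the `O(n→1)` point,
`Δ_{T_L} = L(1-ε/2) + εL(L-1)/(n+8) + O(ε²)`; `Δ_{T₄}(n=2) = 3.11`, `Δ_{T₄}(n=3) = 2.99`,
Carmona–Pelissetto–Vicari cond-mat/9912115, `N_c = 2.89`) extrapolates to `x₄(n=1) ≈ 3.2 > 3`, and the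
`L = 2` member of the same dictionary reproduces the measured HT fractal dimension (`3 - 1.265 = 1.735`
vs `1.7349(65)`, arXiv:0803.2177).  So `ℓ^A[C](l) ≍ l^{-0.2±0.1}`: too slow to be settled by small boxes,
impossible to settle in Lean, and — if right — fatal to the crux, to NT, to `SourceTrailsMeet` and to
the single-current pivot rung alike (the double-current / FK rungs stay `Θ(1)`).
-/

end Summit.CriticalPhenomena.Ising3DConformalLimit.Cruxes.ParityRobustMerging.Disproof

end
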